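/-
Copyright (c) 2026 the pub-hodgecm-mathlib formalisation cell (harness21).  Prover seat hodgecm-mathlib-K2E4-p11 (g5), Track B ∕ K2-LIT, h413 =
`stmt-HodgeConjecture-24833`, line `K2_E1_TraceFormulaBeta`, campaign «EIS-RANK-ONE» ∕ R8-LADDER-2, «MS-2» (σ1)+(σ2) PAIRING SUPPLIER §2 = the CONTINUED HALF, HYPOTHESIS-FIRST
(dealer K2E1-plan (g6) DEAL (42) 2026-09-04T10:07:39Z; heads 10:08Z): for an ABSTRACT continued family `Ec` agreeing with `E(φ₀H^z)` on the tube and holomorphic (pointwise, dominated) on an open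
`D`, the `L²`-pairing `⟪Λ^TẼ(z′), Λ^TẼ(z)⟫` carries the four binders `hΦ₁ hΦ₂ hrel hQ` of ★ p858755 on `D`; §3 calls ★ p858755∕p858922 at `D = D±`.
-/
import Summits.HodgeConjecture.HodgeConjecture.Theorems.K2E1MaassSelbergPairingCMTwo                   -- ★ p859225 §1-file: `pairing_of_differentiableOn`, the tube half; ★ p858755 via its imports
import Summits.HodgeConjecture.HodgeConjecture.Theorems.K2E1MaassSelbergContinuedCMTwoLower           -- ★ p858922: the `D⁻` twin
import Summits.HodgeConjecture.HodgeConjecture.Theorems.K2E1MaassSelbergSphericalBracketsCMTwo           -- ★ (R6k)₂ `maassSelberg_flatSectionU_cm_two_final_spherical`, `measureReal_maximalCompact_pos`; ★ `idelicBracket_*`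
import HarnessLib

/-!
# h413 ∕ Track B «K2-LIT», «MS-2» (σ1)+(σ2) §2 — `K2E1MaassSelbergPairingContinuedCMTwo`: the pairing of the CONTINUED truncated Eisenstein family of `U(1,1)∕CM`, hypothesis-first, and
# the call of the continued Maass–Selberg pole control ★ p858755 ∕ ★ p858922 — [MW] IV.3.12 (a) at `N = 2` MODULO the closer's letters (pointwise holomorphy + a local `L²` majorant of `Λ^TẼ`)

Cell `pub/hodgecm-mathlib`, crux H413 = `stmt-HodgeConjecture-24833`, route `HCCMUnconditional`; dealer K2E1-plan (g6) DEAL (42) 10:07:39Z «GO §2 HYPOTHESIS-FIRST … head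
`pairing_continued_cm_two_of_letters` … ⇒ corollary `poleControl_continued_cm_two_of_letters`».  THEOREMS ONLY (no `def`, no `instance`, no `notation`, no `sorry`); the named inputs are the
LETTERS (hEc)(i′)(m′)(ii′) below (payers: K2E1-p08 (38) B–L by-products + ★ p859196 + ★ K1) and, in §3, the continued scalar `c̃` (★ W5-B); lane `--kind proof --supports
stmt-HodgeConjecture-24833 --as helper` (count-neutral).
THE LETTERS.  `Ec : ℂ → G(𝔸) → ℂ` an abstract family with **(hEc)** `Ec z = E(φ₀H^z)` for `Re z > 1`; `D ⊆ ℂ` open; **(i′)** `∀ g, z ↦ Λ^T Ẽ(z)(g) := truncation ν 𝓕 T (Ec z) g` holomorphic on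
`D`; **(m′)** `quotFun Λ^TẼ(z)` a.e.-strongly measurable on `X` (`z ∈ D`); **(ii′)** locally on `D` a weighted majorant `‖quotFun Λ^TẼ(z)(x)‖ ≤ C·W(x)`, `W ∈ L²(X, μ)` — EXACTLY the currency of ★
`differentiableOn_of_weighted_bound`.  THEN (§1) `z ↦ [Λ^TẼ(z)] ∈ L²(X,μ)` is HOLOMORPHIC on `D`, (§2) the pairing `Φ z z′ := ⟪F z′, F z⟫` has `hΦ₁` on `D`, `hΦ₂` on `conj⁻¹D`, `hQ`, and
on the sub-tube inside `D` it is the left side of ★ (R6k)₂ (by (hEc)), (§3) at `D = D⁺ = {Re > ½, Im > 0}` (`conj⁻¹D⁺ = D⁻`) ★ (R6k)₂ `maassSelberg_flatSectionU_cm_two_final_spherical` (its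
`hdec′` paid by ★ `exists_bound_sub_borelConstantTerm_sphericalEisenstein_cm_two`) and the scalar bookkeeping `κ = ↑κ_ℝ` (★ `idelicBracket_eq_ofReal`), `c̃ = ∫H(w₀v)^z dν` on the tube
(**(hceq)**) put `hrel` in ★ p858755's letters, whence **`poleControl_continued_cm_two_of_letters`** = ★ `poleControl_continued_cm_two_of_pairing` for `c̃` at every `z ∈ D⁺`, and the
`D⁻` twin through ★ p858922.  [MoeglinWaldspurger1995, IV.2.3, IV.3.12 (a); Arthur1980 §4; BernsteinLapid2019 §4 Claim 5.]
* §1 `exists_toLp_differentiableOn_of_letters`.  * §2 HEAD **`pairing_continued_cm_two_of_letters`**.  * §3 **`poleControl_continued_cm_two_of_letters`**, **`…_of_letters_lower`**.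
HONEST LABEL.  Count-neutral helper; proves no printed statement; conditional on the letters (hEc)(i′)(m′)(ii′)(hceq)(hc); HC_CM is proved only modulo the 7 printed citations (2 remaining
named inputs: hLiu418 = `stmt-HodgeConjecture-24832`, h413 = `stmt-HodgeConjecture-24833`) until rung 0 closes.

## References
* [MoeglinWaldspurger1995] C. Mœglin, J.-L. Waldspurger, *Spectral decomposition and Eisenstein series* (1995), IV.2.3, IV.3.12 (a).
* [Arthur1980TraceFormulaII] J. Arthur, *A trace formula for reductive groups II*, Compositio Math. 40 (1980), §4.
* [BernsteinLapid2019] J. Bernstein, E. Lapid, *On the meromorphic continuation of Eisenstein series*, J. AMS 37 (2024), §4 Claim 5.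
-/

set_option autoImplicit false
set_option linter.dupNamespace false  -- the mandated namespace repeats the summit's segment (`HodgeConjecture.HodgeConjecture`)

noncomputable section

open MeasureTheory Measure NumberField IsDedekindDomain Set Filter Topology Metric MulAction
open scoped ENNReal NNReal ComplexConjugate InnerProductSpace
open Literature.MeasureTheory.Group Literature.NumberTheory
open Literature.NumberTheory.Automorphic Literature.NumberTheory.Automorphic.UnitaryGroup AdelicGroupData
open Summit.HodgeConjecture.HodgeConjecture.Cruxes.H413.K2E1BorelEisensteinU
open Summit.HodgeConjecture.HodgeConjecture.Cruxes.H413.K2E1BLHeightPowerHolomorphicU2 (differentiableOn_of_weighted_bound)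
open Summit.HodgeConjecture.HodgeConjecture.Cruxes.H413.K2E1MaassSelbergPairingCMTwo
open Summit.HodgeConjecture.HodgeConjecture.Cruxes.H413.K2E1MaassSelbergContinuedCMTwo (poleControl_continued_cm_two_of_pairing)
open Summit.HodgeConjecture.HodgeConjecture.Cruxes.H413.K2E1MaassSelbergContinuedCMTwoLower (poleControl_continued_cm_two_of_pairing_lower)
open Summit.HodgeConjecture.HodgeConjecture.Cruxes.H413.K2E1MaassSelbergSphericalBracketsCMTwo (maassSelberg_flatSectionU_cm_two_final_spherical measureReal_maximalCompact_pos)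
open Summit.HodgeConjecture.HodgeConjecture.Cruxes.H413.K2E1MaassSelbergPoleControlSphericalCMTwoArch (exists_bound_sub_borelConstantTerm_sphericalEisenstein_cm_two)

namespace Summit.HodgeConjecture.HodgeConjecture.Cruxes.H413.K2E1MaassSelbergPairingContinuedCMTwo

variable (L : Type) [Field L] [NumberField L] [IsCMField L]
-- the Borel structure of `U(J₂)(𝔸_{L⁺})`; `N(𝔸)` carries the induced (subtype) Borel structure
variable [MeasurableSpace (quasiSplit (↥(maximalRealSubfield L)) L (IsCMField.complexConj L) 2).Adelic] [BorelSpace (quasiSplit (↥(maximalRealSubfield L)) L (IsCMField.complexConj L) 2).Adelic]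

/-! ## §1 From the letters to an `L²(X)`-holomorphic family -/

section Family

omit [BorelSpace (quasiSplit (↥(maximalRealSubfield L)) L (IsCMField.complexConj L) 2).Adelic] in
/-- **LETTERS (i′)(m′)(ii′) ⟹ `z ↦ [Λ^TẼ(z)] ∈ L²(X, μ)` IS HOLOMORPHIC ON `D`.**  For any family `Ec`, cut-off `T`, `ν`, `𝓕`, measure `μ` on the automorphic quotient and open `D`: pointwise
holomorphy (i′), measurability (m′) and the local weighted majorant (ii′) give `F : ℂ → L²(X,μ)`, complex differentiable on `D`, with `F z = [quotFun Λ^T(Ec z)]` a.e. for `z ∈ D`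
(★ `differentiableOn_of_weighted_bound` on `interior V`; `MemLp.of_le_mul`). [cite: BernsteinLapid2019, §4 Claim 5] [cite: Rudin1991, Thm. 3.31] -/
theorem exists_toLp_differentiableOn_of_letters
    (ν : Measure (adelicUnipotent (↥(maximalRealSubfield L)) L (IsCMField.complexConj L) 2)) (𝓕 : Set (adelicUnipotent (↥(maximalRealSubfield L)) L (IsCMField.complexConj L) 2)) (T : ℝ≥0)
    (Ec : ℂ → (quasiSplit (↥(maximalRealSubfield L)) L (IsCMField.complexConj L) 2).Adelic → ℂ) (μ : Measure (quasiSplit (↥(maximalRealSubfield L)) L (IsCMField.complexConj L) 2).automorphicQuotient) {D : Set ℂ}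
    (hmeas : ∀ z ∈ D, AEStronglyMeasurable ((quasiSplit (↥(maximalRealSubfield L)) L (IsCMField.complexConj L) 2).quotFun (truncation ν 𝓕 T (Ec z))) μ)
    (hdiff : ∀ g : (quasiSplit (↥(maximalRealSubfield L)) L (IsCMField.complexConj L) 2).Adelic, DifferentiableOn ℂ (fun z : ℂ => truncation ν 𝓕 T (Ec z) g) D)
    (hbd : ∀ z₀ ∈ D, ∃ V ∈ 𝓝 z₀, V ⊆ D ∧ ∃ W : (quasiSplit (↥(maximalRealSubfield L)) L (IsCMField.complexConj L) 2).automorphicQuotient → ℝ, MemLp W 2 μ ∧ ∃ C : ℝ, 0 ≤ C ∧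
      ∀ z ∈ V, ∀ x, ‖(quasiSplit (↥(maximalRealSubfield L)) L (IsCMField.complexConj L) 2).quotFun (truncation ν 𝓕 T (Ec z)) x‖ ≤ C * W x) :
    ∃ F : ℂ → Lp ℂ 2 μ, DifferentiableOn ℂ F D ∧ ∀ z ∈ D, ((F z : Lp ℂ 2 μ) : (quasiSplit (↥(maximalRealSubfield L)) L (IsCMField.complexConj L) 2).automorphicQuotient → ℂ) =ᵐ[μ] (quasiSplit (↥(maximalRealSubfield L)) L (IsCMField.complexConj L) 2).quotFun (truncation ν 𝓕 T (Ec z)) := by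
  classical
  -- `L²` membership at each point of `D`
  have hmem : ∀ z ∈ D, MemLp ((quasiSplit (↥(maximalRealSubfield L)) L (IsCMField.complexConj L) 2).quotFun (truncation ν 𝓕 T (Ec z))) 2 μ := by
    intro z hz
    obtain ⟨V, hV, -, W, hW, C, hC0, hCW⟩ := hbd z hz
    refine MemLp.of_le_mul (c := C) hW (hmeas z hz) (Eventually.of_forall fun x => ?_)
    exact (hCW z (mem_of_mem_nhds hV) x).trans (mul_le_mul_of_nonneg_left (Real.le_norm_self _) hC0)
  refine ⟨fun z => if h : MemLp ((quasiSplit (↥(maximalRealSubfield L)) L (IsCMField.complexConj L) 2).quotFun (truncation ν 𝓕 T (Ec z))) 2 μ then h.toLp _ else 0, ?_, fun z hz => ?_⟩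
  swap
  · dsimp only
    rw [dif_pos (hmem z hz)]
    exact MemLp.coeFn_toLp _
  intro z₀ hz₀
  obtain ⟨V, hV, hVD, W, hW, C, hC0, hCW⟩ := hbd z₀ hz₀
  have h0V : z₀ ∈ interior V := mem_interior_iff_mem_nhds.2 hV
  have hIV : interior V ⊆ D := interior_subset.trans hVD
  have hdiffV : DifferentiableOn ℂ (fun z => if h : MemLp ((quasiSplit (↥(maximalRealSubfield L)) L (IsCMField.complexConj L) 2).quotFun (truncation ν 𝓕 T (Ec z))) 2 μ then h.toLp _ else 0) (interior V) := by
    refine differentiableOn_of_weighted_bound (μ := μ) (f := fun z => (quasiSplit (↥(maximalRealSubfield L)) L (IsCMField.complexConj L) 2).quotFun (truncation ν 𝓕 T (Ec z))) isOpen_interior (fun x => (hdiff _).mono hIV) (fun s hs => hmeas s (hIV hs))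
      hW hC0 (fun s hs x => hCW s (interior_subset hs) x) (fun s hs => ?_)
    show (((if h : MemLp ((quasiSplit (↥(maximalRealSubfield L)) L (IsCMField.complexConj L) 2).quotFun (truncation ν 𝓕 T (Ec s))) 2 μ then h.toLp _ else 0 : Lp ℂ 2 μ)) : (quasiSplit (↥(maximalRealSubfield L)) L (IsCMField.complexConj L) 2).automorphicQuotient → ℂ) =ᵐ[μ] (quasiSplit (↥(maximalRealSubfield L)) L (IsCMField.complexConj L) 2).quotFun (truncation ν 𝓕 T (Ec s))
    rw [dif_pos (hmem s (hIV hs))]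
    exact MemLp.coeFn_toLp _
  exact ((hdiffV z₀ h0V).differentiableAt (isOpen_interior.mem_nhds h0V)).differentiableWithinAt

end Family

/-! ## §2 HEAD: the pairing of the continued family — `hΦ₁`, `hΦ₂`, `hQ` on `D`, and the raw `hrel` on the sub-tube -/

section Pairing

omit [BorelSpace (quasiSplit (↥(maximalRealSubfield L)) L (IsCMField.complexConj L) 2).Adelic] in
/-- **HEAD — THE PAIRING OF THE CONTINUED FAMILY, HYPOTHESIS-FIRST.**  Letters: (hEc) `Ec z = E(φ₀H^z)` for `Re z > 1`; `D` open; (i′) pointwise holomorphy of `z ↦ Λ^TẼ(z)(g)` on `D`;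
(m′) measurability on `X`; (ii′) the local weighted `L²` majorant.  THEN there is `F : ℂ → L²(X, μ)` with `F z = [Λ^TẼ(z)]` a.e. (`z ∈ D`) such that for `Φ z z′ := ⟪F z′, F z⟫`:
(`hΦ₁`) `z ↦ Φ z z′` holomorphic on `D`; (`hΦ₂`) `w ↦ Φ z (conj w)` holomorphic on `conj⁻¹D`; (`hQ`) `Φ z z = ‖F z‖² ≥ 0`; and for `z, z′ ∈ D` on the tube `Re > 1`, `Φ z z′ = ∫_X Λ^TE(z)·conj Λ^TE(z′) dμ`
— the left side of ★ (R6k)₂ VERBATIM (§1 + ★ `pairing_of_differentiableOn` + (hEc)). [cite: MoeglinWaldspurger1995, IV.3.12] [cite: BernsteinLapid2019, §4 Claim 5] -/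
theorem pairing_continued_cm_two_of_letters
    (ν : Measure (adelicUnipotent (↥(maximalRealSubfield L)) L (IsCMField.complexConj L) 2)) (𝓕 : Set (adelicUnipotent (↥(maximalRealSubfield L)) L (IsCMField.complexConj L) 2)) (T : ℝ≥0) (φ₀ : ℂ)
    (Ec : ℂ → (quasiSplit (↥(maximalRealSubfield L)) L (IsCMField.complexConj L) 2).Adelic → ℂ) (hEc : ∀ z : ℂ, 1 < z.re → Ec z = eisensteinSeriesU (flatSectionU (fun _ : (quasiSplit (↥(maximalRealSubfield L)) L (IsCMField.complexConj L) 2).Adelic => φ₀) z))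
    (μ : Measure (quasiSplit (↥(maximalRealSubfield L)) L (IsCMField.complexConj L) 2).automorphicQuotient) {D : Set ℂ} (hD : IsOpen D)
    (hmeas : ∀ z ∈ D, AEStronglyMeasurable ((quasiSplit (↥(maximalRealSubfield L)) L (IsCMField.complexConj L) 2).quotFun (truncation ν 𝓕 T (Ec z))) μ)
    (hdiff : ∀ g : (quasiSplit (↥(maximalRealSubfield L)) L (IsCMField.complexConj L) 2).Adelic, DifferentiableOn ℂ (fun z : ℂ => truncation ν 𝓕 T (Ec z) g) D)
    (hbd : ∀ z₀ ∈ D, ∃ V ∈ 𝓝 z₀, V ⊆ D ∧ ∃ W : (quasiSplit (↥(maximalRealSubfield L)) L (IsCMField.complexConj L) 2).automorphicQuotient → ℝ, MemLp W 2 μ ∧ ∃ C : ℝ, 0 ≤ C ∧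
      ∀ z ∈ V, ∀ x, ‖(quasiSplit (↥(maximalRealSubfield L)) L (IsCMField.complexConj L) 2).quotFun (truncation ν 𝓕 T (Ec z)) x‖ ≤ C * W x) :
    ∃ F : ℂ → Lp ℂ 2 μ,
      (∀ z ∈ D, ((F z : Lp ℂ 2 μ) : (quasiSplit (↥(maximalRealSubfield L)) L (IsCMField.complexConj L) 2).automorphicQuotient → ℂ) =ᵐ[μ] (quasiSplit (↥(maximalRealSubfield L)) L (IsCMField.complexConj L) 2).quotFun (truncation ν 𝓕 T (Ec z))) ∧
      (∀ z' ∈ D, DifferentiableOn ℂ (fun z : ℂ => ⟪F z', F z⟫_ℂ) D) ∧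
      (∀ z ∈ D, DifferentiableOn ℂ (fun w : ℂ => ⟪F (conj w), F z⟫_ℂ) {w : ℂ | conj w ∈ D}) ∧
      (∀ z ∈ D, 0 ≤ ‖F z‖ ^ 2 ∧ ⟪F z, F z⟫_ℂ = (((‖F z‖ ^ 2 : ℝ)) : ℂ)) ∧
      (∀ z ∈ D, ∀ z' ∈ D, 1 < z.re → 1 < z'.re →
        ⟪F z', F z⟫_ℂ = ∫ x, (quasiSplit (↥(maximalRealSubfield L)) L (IsCMField.complexConj L) 2).quotFun (truncation ν 𝓕 T (eisensteinSeriesU (flatSectionU (fun _ : (quasiSplit (↥(maximalRealSubfield L)) L (IsCMField.complexConj L) 2).Adelic => φ₀) z))) x * conj ((quasiSplit (↥(maximalRealSubfield L)) L (IsCMField.complexConj L) 2).quotFun (truncation ν 𝓕 T (eisensteinSeriesU (flatSectionU (fun _ : (quasiSplit (↥(maximalRealSubfield L)) L (IsCMField.complexConj L) 2).Adelic => φ₀) z'))) x) ∂μ) := by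
  obtain ⟨F, hFd, hF⟩ := exists_toLp_differentiableOn_of_letters L ν 𝓕 T Ec μ hmeas hdiff hbd
  obtain ⟨h₁, h₂, h₃⟩ := pairing_of_differentiableOn hD hFd
  refine ⟨F, hF, h₁, h₂, h₃, fun z hz z' hz' hz1 hz'1 => ?_⟩
  rw [MeasureTheory.L2.inner_def]
  refine integral_congr_ae ?_
  filter_upwards [hF z hz, hF z' hz'] with x hx hx'
  rw [hx, hx', RCLike.inner_apply, hEc z hz1, hEc z' hz'1, mul_comm]

end Pairing

/-! ## §3 The call of the continued Maass–Selberg pole control: [MW] IV.3.12 (a) at `N = 2` modulo the letters -/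

section Call

variable [MeasurableSpace (AdeleRing (𝓞 L) L)ˣ] [BorelSpace (AdeleRing (𝓞 L) L)ˣ]

/-- **THE FOUR-TERM ON THE SUB-TUBE IN THE CONSUMER'S LETTERS**: for the structural data of ★ (R6k)₂, `φ₀`, and a scalar `c` with **(hceq)** `c z = ∫_{N(𝔸)} H(ι(w₀)·v)^z dν` on `Re z > 1`, there are
`cμ, K > 0` with `∫_X Λ^TE(z)·conj Λ^TE(z′) dμ = R(z, z′; c)` for `1 < Re z′ < Re z` in EXACTLY the shape of ★ `poleControl_continued_cm_two_of_pairing`'s `hrel` (`κ = κ_ℝ` the real idelic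
bracket, `m = μ_K(K_U)`): ★ `maassSelberg_flatSectionU_cm_two_final_spherical` with its survivor `hdec′` PAID by ★ `exists_bound_sub_borelConstantTerm_sphericalEisenstein_cm_two`, then `κ = ↑κ_ℝ`
(★ `idelicBracket_eq_ofReal`) and (hceq). [cite: MoeglinWaldspurger1995, IV.2.3] [cite: Arthur1980TraceFormulaII, §4] -/
theorem exists_fourTerm_tube_cm_two
    (μ : Measure (quasiSplit (↥(maximalRealSubfield L)) L (IsCMField.complexConj L) 2).automorphicQuotient) [(quasiSplit (↥(maximalRealSubfield L)) L (IsCMField.complexConj L) 2).IsAutomorphicMeasure μ]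
    (νG : Measure (quasiSplit (↥(maximalRealSubfield L)) L (IsCMField.complexConj L) 2).Adelic) [νG.IsHaarMeasure] [νG.IsInvInvariant]
    (μK : Measure ((standardMaximalCompactGL 2 L).comap (adelicVal (↥(maximalRealSubfield L)) L (IsCMField.complexConj L) 2 ((StdForm.antidiagonal 2).over L)) : Subgroup (quasiSplit (↥(maximalRealSubfield L)) L (IsCMField.complexConj L) 2).Adelic))
    [μK.IsHaarMeasure]
    (νI : Measure (AdeleRing (𝓞 L) L)ˣ) [νI.IsHaarMeasure]
    {𝓕I : Set (AdeleRing (𝓞 L) L)ˣ} (h𝓕I : IsIdeleClassDomain L 𝓕I)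
    (ν : Measure ↥(adelicUnipotent (↥(maximalRealSubfield L)) L (IsCMField.complexConj L) 2)) [ν.IsHaarMeasure]
    {𝓕 : Set ↥(adelicUnipotent (↥(maximalRealSubfield L)) L (IsCMField.complexConj L) 2)} (h𝓕N : IsFundamentalDomain ↥(rationalUnipotent (↥(maximalRealSubfield L)) L (IsCMField.complexConj L) 2) 𝓕 ν) (h𝓕1 : ν 𝓕 = 1)
    (h𝓕c : IsCompact (closure 𝓕))
    (T : ℝ≥0) (hT : 1 ≤ T) (φ₀ : ℂ)
    {β : (quasiSplit (↥(maximalRealSubfield L)) L (IsCMField.complexConj L) 2).Adelic → ℝ≥0∞} (hβ : IsCoveringWeight ((arithmeticBorel (↥(maximalRealSubfield L)) L (IsCMField.complexConj L) 2).map (quasiSplit (↥(maximalRealSubfield L)) L (IsCMField.complexConj L) 2).arithmeticSubgroup.subtype) β)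
    (c : ℂ → ℂ) (hceq : ∀ z : ℂ, 1 < z.re → c z = (∫ v : ↥(adelicUnipotent (↥(maximalRealSubfield L)) L (IsCMField.complexConj L) 2), (((borelHeight ((quasiSplit (↥(maximalRealSubfield L)) L (IsCMField.complexConj L) 2).toAdelic (weylLongU ((IsCMField.complexConj L : L ≃ₐ[↥(maximalRealSubfield L)] L) : L →+* L) (rfl : (StdForm.antidiagonal 2).over L = (StdForm.antidiagonal 2).over L)) * (v : (quasiSplit (↥(maximalRealSubfield L)) L (IsCMField.complexConj L) 2).Adelic))) : ℝ) : ℂ) ^ z ∂ν)) :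
    ∃ cμ K : ℝ, 0 < cμ ∧ 0 < K ∧ ∀ z z' : ℂ, 1 < z'.re → z'.re < z.re →
      ∫ x, (quasiSplit (↥(maximalRealSubfield L)) L (IsCMField.complexConj L) 2).quotFun (truncation ν 𝓕 T (eisensteinSeriesU (flatSectionU (fun _ : (quasiSplit (↥(maximalRealSubfield L)) L (IsCMField.complexConj L) 2).Adelic => φ₀) z))) x * conj ((quasiSplit (↥(maximalRealSubfield L)) L (IsCMField.complexConj L) 2).quotFun (truncation ν 𝓕 T (eisensteinSeriesU (flatSectionU (fun _ : (quasiSplit (↥(maximalRealSubfield L)) L (IsCMField.complexConj L) 2).Adelic => φ₀) z'))) x) ∂μ =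
      ((cμ : ℝ) : ℂ) * (((K : ℝ) : ℂ) *
        ((((T : ℝ) : ℂ) ^ (z + conj z' - 1) / (z + conj z' - 1)) * ((((∫ x in {x : (AdeleRing (𝓞 L) L)ˣ | (IdeleClassGroup.ideleNorm L x : ℝ) ≤ 1} ∩ 𝓕I, (IdeleClassGroup.ideleNorm L x : ℝ) ∂νI) : ℝ) : ℂ) * (((μK.real Set.univ : ℝ) : ℂ) * (φ₀ * conj φ₀)))
          + (((T : ℝ) : ℂ) ^ (z - conj z') / (z - conj z')) * ((((∫ x in {x : (AdeleRing (𝓞 L) L)ˣ | (IdeleClassGroup.ideleNorm L x : ℝ) ≤ 1} ∩ 𝓕I, (IdeleClassGroup.ideleNorm L x : ℝ) ∂νI) : ℝ) : ℂ) * (((μK.real Set.univ : ℝ) : ℂ) * (φ₀ * conj (c z' * φ₀))))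
          - (((T : ℝ) : ℂ) ^ (-(z - conj z')) / (z - conj z')) * ((((∫ x in {x : (AdeleRing (𝓞 L) L)ˣ | (IdeleClassGroup.ideleNorm L x : ℝ) ≤ 1} ∩ 𝓕I, (IdeleClassGroup.ideleNorm L x : ℝ) ∂νI) : ℝ) : ℂ) * (((μK.real Set.univ : ℝ) : ℂ) * (c z * φ₀ * conj φ₀)))
          - (((T : ℝ) : ℂ) ^ (-(z + conj z' - 1)) / (z + conj z' - 1)) * ((((∫ x in {x : (AdeleRing (𝓞 L) L)ˣ | (IdeleClassGroup.ideleNorm L x : ℝ) ≤ 1} ∩ 𝓕I, (IdeleClassGroup.ideleNorm L x : ℝ) ∂νI) : ℝ) : ℂ) * (((μK.real Set.univ : ℝ) : ℂ) * (c z * φ₀ * conj (c z' * φ₀)))))) := by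
  obtain ⟨cμ, K, hcμ, hK, h⟩ := maassSelberg_flatSectionU_cm_two_final_spherical L μ νG μK νI h𝓕I ν h𝓕N h𝓕1 h𝓕c
  -- a trace-zero letter and the archimedean order for the unconditional decay
  obtain ⟨δ, hδ, hcδ⟩ : ∃ δ : L, δ ≠ 0 ∧ IsCMField.complexConj L δ = -δ := by
    obtain ⟨x, hx⟩ : ∃ x : L, IsCMField.complexConj L x ≠ x := by
      by_contra h'
      exact IsCMField.complexConj_ne_one (K := L) (AlgEquiv.ext fun x => not_not.1 fun hx => h' ⟨x, hx⟩)
    exact ⟨x - IsCMField.complexConj L x, sub_ne_zero.2 (Ne.symm hx), by rw [map_sub, IsCMField.complexConj_apply_apply, neg_sub]⟩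
  have hm : (Module.finrank ℚ ↥(maximalRealSubfield L) : ℝ) < (Module.finrank ℚ ↥(maximalRealSubfield L) + 1 : ℕ) := by exact_mod_cast Nat.lt_succ_self _
  have hκ : (∫ x in {x : (AdeleRing (𝓞 L) L)ˣ | (IdeleClassGroup.ideleNorm L x : ℝ) ≤ 1} ∩ 𝓕I, ((IdeleClassGroup.ideleNorm L x : ℝ) : ℂ) ∂νI) = ((((∫ x in {x : (AdeleRing (𝓞 L) L)ˣ | (IdeleClassGroup.ideleNorm L x : ℝ) ≤ 1} ∩ 𝓕I, (IdeleClassGroup.ideleNorm L x : ℝ) ∂νI)) : ℝ) : ℂ) := K2E1MaassSelbergSphericalBracketsCMThree.idelicBracket_eq_ofReal νI 𝓕I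
  refine ⟨cμ, K, hcμ, hK, fun z z' hz' hzz' => ?_⟩
  obtain ⟨M₁, hM₁⟩ := exists_bound_sub_borelConstantTerm_sphericalEisenstein_cm_two L hcδ hδ ν h𝓕N h𝓕c hm hT φ₀ (isCompact_singleton (x := z'))
    (fun w hw => by rw [Set.mem_singleton_iff.1 hw]; exact hz') (R := ‖z'‖) (fun w hw => by rw [Set.mem_singleton_iff.1 hw])
  have key := h hβ hT φ₀ φ₀ hz' hzz' (hM₁ z' (Set.mem_singleton z'))
  rw [hκ, ← hceq z (hz'.trans hzz'), ← hceq z' hz'] at key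
  exact key

/-- **POLE CONTROL OF THE CONTINUED SCALAR `c̃` ON `D⁺ = {Re z > ½, Im z > 0}` — [MW] IV.3.12 (a) AT `N = 2`, MODULO THE LETTERS.**  Structural data of ★ (R6k)₂; `φ₀ ≠ 0`; the continued scalar
`c` holomorphic on `D⁺` (★ W5-B) with (hceq) on the tube; the continued Eisenstein family `Ec` with (hEc) and the letters (i′)(m′)(ii′) ON `D⁺`.  THEN at every `z ∈ D⁺`: (a1)∧(a2)∧(a3) of ★
`poleControl_continued_cm_two_of_pairing` for `c`, with `a = κ_ℝ·m·|φ₀|²`, `b = κ_ℝ·m·|c z|²|φ₀|²`, `x = Re z − ½`, `y = Im z` (`κ_ℝ` the idelic bracket, `m = μ_K(K_U)`) — **`c` has no pole on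
`{½ < Re ≤ 1} ∩ {Im > 0}` beyond `O(|y|⁻¹)` growth**.  Proof: §2 at `D := D⁺` (`conj⁻¹D⁺ = D⁻`) supplies `Φ`, `hΦ₁ hΦ₂ hQ`; `hrel` = §2's raw identity ∘ `exists_fourTerm_tube_cm_two`; then ★ p858755.
[cite: MoeglinWaldspurger1995, IV.3.12 (a)] [cite: Arthur1980TraceFormulaII, §4] [cite: BernsteinLapid2019, §4] -/
theorem poleControl_continued_cm_two_of_letters
    (μ : Measure (quasiSplit (↥(maximalRealSubfield L)) L (IsCMField.complexConj L) 2).automorphicQuotient) [(quasiSplit (↥(maximalRealSubfield L)) L (IsCMField.complexConj L) 2).IsAutomorphicMeasure μ]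
    (νG : Measure (quasiSplit (↥(maximalRealSubfield L)) L (IsCMField.complexConj L) 2).Adelic) [νG.IsHaarMeasure] [νG.IsInvInvariant]
    (μK : Measure ((standardMaximalCompactGL 2 L).comap (adelicVal (↥(maximalRealSubfield L)) L (IsCMField.complexConj L) 2 ((StdForm.antidiagonal 2).over L)) : Subgroup (quasiSplit (↥(maximalRealSubfield L)) L (IsCMField.complexConj L) 2).Adelic))
    [μK.IsHaarMeasure]
    (νI : Measure (AdeleRing (𝓞 L) L)ˣ) [νI.IsHaarMeasure]
    {𝓕I : Set (AdeleRing (𝓞 L) L)ˣ} (h𝓕I : IsIdeleClassDomain L 𝓕I)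
    (ν : Measure ↥(adelicUnipotent (↥(maximalRealSubfield L)) L (IsCMField.complexConj L) 2)) [ν.IsHaarMeasure]
    {𝓕 : Set ↥(adelicUnipotent (↥(maximalRealSubfield L)) L (IsCMField.complexConj L) 2)} (h𝓕N : IsFundamentalDomain ↥(rationalUnipotent (↥(maximalRealSubfield L)) L (IsCMField.complexConj L) 2) 𝓕 ν) (h𝓕1 : ν 𝓕 = 1)
    (h𝓕c : IsCompact (closure 𝓕))
    {T : ℝ≥0} (hT : 1 ≤ T) {φ₀ : ℂ} (hφ₀ : φ₀ ≠ 0)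
    {β : (quasiSplit (↥(maximalRealSubfield L)) L (IsCMField.complexConj L) 2).Adelic → ℝ≥0∞} (hβ : IsCoveringWeight ((arithmeticBorel (↥(maximalRealSubfield L)) L (IsCMField.complexConj L) 2).map (quasiSplit (↥(maximalRealSubfield L)) L (IsCMField.complexConj L) 2).arithmeticSubgroup.subtype) β)
    {c : ℂ → ℂ} (hc : DifferentiableOn ℂ c {z : ℂ | 1 / 2 < z.re ∧ 0 < z.im}) (hceq : ∀ z : ℂ, 1 < z.re → c z = (∫ v : ↥(adelicUnipotent (↥(maximalRealSubfield L)) L (IsCMField.complexConj L) 2), (((borelHeight ((quasiSplit (↥(maximalRealSubfield L)) L (IsCMField.complexConj L) 2).toAdelic (weylLongU ((IsCMField.complexConj L : L ≃ₐ[↥(maximalRealSubfield L)] L) : L →+* L) (rfl : (StdForm.antidiagonal 2).over L = (StdForm.antidiagonal 2).over L)) * (v : (quasiSplit (↥(maximalRealSubfield L)) L (IsCMField.complexConj L) 2).Adelic))) : ℝ) : ℂ) ^ z ∂ν))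
    (Ec : ℂ → (quasiSplit (↥(maximalRealSubfield L)) L (IsCMField.complexConj L) 2).Adelic → ℂ) (hEc : ∀ z : ℂ, 1 < z.re → Ec z = eisensteinSeriesU (flatSectionU (fun _ : (quasiSplit (↥(maximalRealSubfield L)) L (IsCMField.complexConj L) 2).Adelic => φ₀) z))
    (hmeas : ∀ z ∈ {z : ℂ | 1 / 2 < z.re ∧ 0 < z.im}, AEStronglyMeasurable ((quasiSplit (↥(maximalRealSubfield L)) L (IsCMField.complexConj L) 2).quotFun (truncation ν 𝓕 T (Ec z))) μ)
    (hdiff : ∀ g : (quasiSplit (↥(maximalRealSubfield L)) L (IsCMField.complexConj L) 2).Adelic, DifferentiableOn ℂ (fun z : ℂ => truncation ν 𝓕 T (Ec z) g) {z : ℂ | 1 / 2 < z.re ∧ 0 < z.im})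
    (hbd : ∀ z₀ ∈ {z : ℂ | 1 / 2 < z.re ∧ 0 < z.im}, ∃ V ∈ 𝓝 z₀, V ⊆ {z : ℂ | 1 / 2 < z.re ∧ 0 < z.im} ∧ ∃ W : (quasiSplit (↥(maximalRealSubfield L)) L (IsCMField.complexConj L) 2).automorphicQuotient → ℝ, MemLp W 2 μ ∧ ∃ C : ℝ, 0 ≤ C ∧
      ∀ z ∈ V, ∀ x, ‖(quasiSplit (↥(maximalRealSubfield L)) L (IsCMField.complexConj L) 2).quotFun (truncation ν 𝓕 T (Ec z)) x‖ ≤ C * W x)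
    {z : ℂ} (hz : z ∈ {z : ℂ | 1 / 2 < z.re ∧ 0 < z.im}) :
    Real.sqrt ((∫ x in {x : (AdeleRing (𝓞 L) L)ˣ | (IdeleClassGroup.ideleNorm L x : ℝ) ≤ 1} ∩ 𝓕I, (IdeleClassGroup.ideleNorm L x : ℝ) ∂νI) * μK.real Set.univ * ‖c z‖ ^ 2 * ‖φ₀‖ ^ 2) ≤ (z.re - 1 / 2) * (T : ℝ) ^ (2 * (z.re - 1 / 2)) * Real.sqrt ((∫ x in {x : (AdeleRing (𝓞 L) L)ˣ | (IdeleClassGroup.ideleNorm L x : ℝ) ≤ 1} ∩ 𝓕I, (IdeleClassGroup.ideleNorm L x : ℝ) ∂νI) * μK.real Set.univ * ‖φ₀‖ ^ 2) / |z.im| +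
        Real.sqrt ((z.re - 1 / 2) ^ 2 * (T : ℝ) ^ (4 * (z.re - 1 / 2)) * ((∫ x in {x : (AdeleRing (𝓞 L) L)ˣ | (IdeleClassGroup.ideleNorm L x : ℝ) ≤ 1} ∩ 𝓕I, (IdeleClassGroup.ideleNorm L x : ℝ) ∂νI) * μK.real Set.univ * ‖φ₀‖ ^ 2) / z.im ^ 2 + ((∫ x in {x : (AdeleRing (𝓞 L) L)ˣ | (IdeleClassGroup.ideleNorm L x : ℝ) ≤ 1} ∩ 𝓕I, (IdeleClassGroup.ideleNorm L x : ℝ) ∂νI) * μK.real Set.univ * ‖φ₀‖ ^ 2) * (T : ℝ) ^ (4 * (z.re - 1 / 2))) ∧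
      (∀ {x₁ x₂ η : ℝ}, 0 < x₁ → (z.re - 1 / 2) ∈ Set.Icc x₁ x₂ → 0 < η → η ≤ |z.im| →
        (∫ x in {x : (AdeleRing (𝓞 L) L)ˣ | (IdeleClassGroup.ideleNorm L x : ℝ) ≤ 1} ∩ 𝓕I, (IdeleClassGroup.ideleNorm L x : ℝ) ∂νI) * μK.real Set.univ * ‖c z‖ ^ 2 * ‖φ₀‖ ^ 2 ≤ (x₂ * (T : ℝ) ^ (2 * x₂) * Real.sqrt ((∫ x in {x : (AdeleRing (𝓞 L) L)ˣ | (IdeleClassGroup.ideleNorm L x : ℝ) ≤ 1} ∩ 𝓕I, (IdeleClassGroup.ideleNorm L x : ℝ) ∂νI) * μK.real Set.univ * ‖φ₀‖ ^ 2) / η + Real.sqrt (x₂ ^ 2 * (T : ℝ) ^ (4 * x₂) * ((∫ x in {x : (AdeleRing (𝓞 L) L)ˣ | (IdeleClassGroup.ideleNorm L x : ℝ) ≤ 1} ∩ 𝓕I, (IdeleClassGroup.ideleNorm L x : ℝ) ∂νI) * μK.real Set.univ * ‖φ₀‖ ^ 2) / η ^ 2 + ((∫ x in {x : (AdeleRing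 (𝓞 L) L)ˣ | (IdeleClassGroup.ideleNorm L x : ℝ) ≤ 1} ∩ 𝓕I, (IdeleClassGroup.ideleNorm L x : ℝ) ∂νI) * μK.real Set.univ * ‖φ₀‖ ^ 2) * (T : ℝ) ^ (4 * x₂))) ^ 2) ∧
      (|z.im| ≤ 1 → (∫ x in {x : (AdeleRing (𝓞 L) L)ˣ | (IdeleClassGroup.ideleNorm L x : ℝ) ≤ 1} ∩ 𝓕I, (IdeleClassGroup.ideleNorm L x : ℝ) ∂νI) * μK.real Set.univ * ‖c z‖ ^ 2 * ‖φ₀‖ ^ 2 ≤ ((z.re - 1 / 2) * (T : ℝ) ^ (2 * (z.re - 1 / 2)) * Real.sqrt ((∫ x in {x : (AdeleRing (𝓞 L) L)ˣ | (IdeleClassGroup.ideleNorm L x : ℝ) ≤ 1} ∩ 𝓕I, (IdeleClassGroup.ideleNorm L x : ℝ) ∂νI) * μK.real Set.univ * ‖φ₀‖ ^ 2) +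
        Real.sqrt ((z.re - 1 / 2) ^ 2 * (T : ℝ) ^ (4 * (z.re - 1 / 2)) * ((∫ x in {x : (AdeleRing (𝓞 L) L)ˣ | (IdeleClassGroup.ideleNorm L x : ℝ) ≤ 1} ∩ 𝓕I, (IdeleClassGroup.ideleNorm L x : ℝ) ∂νI) * μK.real Set.univ * ‖φ₀‖ ^ 2) + ((∫ x in {x : (AdeleRing (𝓞 L) L)ˣ | (IdeleClassGroup.ideleNorm L x : ℝ) ≤ 1} ∩ 𝓕I, (IdeleClassGroup.ideleNorm L x : ℝ) ∂νI) * μK.real Set.univ * ‖φ₀‖ ^ 2) * (T : ℝ) ^ (4 * (z.re - 1 / 2)))) ^ 2 / z.im ^ 2)  := by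
  have hDo : IsOpen {z : ℂ | 1 / 2 < z.re ∧ 0 < z.im} := (isOpen_lt continuous_const Complex.continuous_re).inter (isOpen_lt continuous_const Complex.continuous_im)
  obtain ⟨F, hF, hΦ₁, hΦ₂, hQ, hraw⟩ := pairing_continued_cm_two_of_letters L ν 𝓕 T φ₀ Ec hEc μ hDo hmeas hdiff hbd
  obtain ⟨cμ, K, hcμ, hK, h4⟩ := exists_fourTerm_tube_cm_two L μ νG μK νI h𝓕I ν h𝓕N h𝓕1 h𝓕c T hT φ₀ hβ c hceq
  have hκr : 0 < (∫ x in {x : (AdeleRing (𝓞 L) L)ˣ | (IdeleClassGroup.ideleNorm L x : ℝ) ≤ 1} ∩ 𝓕I, (IdeleClassGroup.ideleNorm L x : ℝ) ∂νI) := K2E1MaassSelbergSphericalBracketsCMThree.idelicBracket_pos νI h𝓕I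
  have hmK : 0 < μK.real Set.univ := measureReal_maximalCompact_pos μK
  have hconj : {w : ℂ | conj w ∈ {z : ℂ | 1 / 2 < z.re ∧ 0 < z.im}} = {w : ℂ | 1 / 2 < w.re ∧ w.im < 0} := by
    ext w; simp only [Set.mem_setOf_eq, Complex.conj_re, Complex.conj_im, Left.neg_pos_iff]
  have hΦ₂' : ∀ z ∈ {z : ℂ | 1 / 2 < z.re ∧ 0 < z.im}, DifferentiableOn ℂ (fun w : ℂ => ⟪F (conj w), F z⟫_ℂ) {w : ℂ | 1 / 2 < w.re ∧ w.im < 0} := fun z hz => hconj ▸ hΦ₂ z hz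
  have hrel : ∀ z ∈ {z : ℂ | 1 / 2 < z.re ∧ 0 < z.im}, ∀ z' ∈ {z : ℂ | 1 / 2 < z.re ∧ 0 < z.im}, 1 < z'.re → z'.re < z.re →
      ⟪F z', F z⟫_ℂ = ((cμ : ℝ) : ℂ) * (((K : ℝ) : ℂ) *
        ((((T : ℝ) : ℂ) ^ (z + conj z' - 1) / (z + conj z' - 1)) * ((((∫ x in {x : (AdeleRing (𝓞 L) L)ˣ | (IdeleClassGroup.ideleNorm L x : ℝ) ≤ 1} ∩ 𝓕I, (IdeleClassGroup.ideleNorm L x : ℝ) ∂νI) : ℝ) : ℂ) * (((μK.real Set.univ : ℝ) : ℂ) * (φ₀ * conj φ₀)))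
          + (((T : ℝ) : ℂ) ^ (z - conj z') / (z - conj z')) * ((((∫ x in {x : (AdeleRing (𝓞 L) L)ˣ | (IdeleClassGroup.ideleNorm L x : ℝ) ≤ 1} ∩ 𝓕I, (IdeleClassGroup.ideleNorm L x : ℝ) ∂νI) : ℝ) : ℂ) * (((μK.real Set.univ : ℝ) : ℂ) * (φ₀ * conj (c z' * φ₀))))
          - (((T : ℝ) : ℂ) ^ (-(z - conj z')) / (z - conj z')) * ((((∫ x in {x : (AdeleRing (𝓞 L) L)ˣ | (IdeleClassGroup.ideleNorm L x : ℝ) ≤ 1} ∩ 𝓕I, (IdeleClassGroup.ideleNorm L x : ℝ) ∂νI) : ℝ) : ℂ) * (((μK.real Set.univ : ℝ) : ℂ) * (c z * φ₀ * conj φ₀)))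
          - (((T : ℝ) : ℂ) ^ (-(z + conj z' - 1)) / (z + conj z' - 1)) * ((((∫ x in {x : (AdeleRing (𝓞 L) L)ˣ | (IdeleClassGroup.ideleNorm L x : ℝ) ≤ 1} ∩ 𝓕I, (IdeleClassGroup.ideleNorm L x : ℝ) ∂νI) : ℝ) : ℂ) * (((μK.real Set.univ : ℝ) : ℂ) * (c z * φ₀ * conj (c z' * φ₀)))))) := by
    intro z hz z' hz' h1 h2
    rw [hraw z hz z' hz' (h1.trans h2) h1]
    exact h4 z z' h1 h2
  exact poleControl_continued_cm_two_of_pairing (T := (T : ℝ)) (by exact_mod_cast hT) hcμ hK hκr hmK hφ₀ hc (Φ := fun z z' => ⟪F z', F z⟫_ℂ) hΦ₁ hΦ₂' hrel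
    (Q := fun z => ‖F z‖ ^ 2) hQ hz

/-- **THE LOWER QUADRANT `D⁻ = {Re z > ½, Im z < 0}`**: the same with the letters on `D⁻`, `c` holomorphic on `D⁻`, through ★ p858922 `poleControl_continued_cm_two_of_pairing_lower` (`conj⁻¹D⁻ = D⁺`). **POLE CONTROL OF THE CONTINUED SCALAR `c̃` ON `D⁻` — [MW] IV.3.12 (a) AT `N = 2`, MODULO THE LETTERS.**  Structural data of ★ (R6k)₂; `φ₀ ≠ 0`; the continued scalar
`c` holomorphic on `D⁺` (★ W5-B) with (hceq) on the tube; the continued Eisenstein family `Ec` with (hEc) and the letters (i′)(m′)(ii′) ON `D⁺`.  THEN at every `z ∈ D⁺`: (a1)∧(a2)∧(a3) of ★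
`poleControl_continued_cm_two_of_pairing` for `c`, with `a = κ_ℝ·m·|φ₀|²`, `b = κ_ℝ·m·|c z|²|φ₀|²`, `x = Re z − ½`, `y = Im z` (`κ_ℝ` the idelic bracket, `m = μ_K(K_U)`) — **`c` has no pole on
`{½ < Re ≤ 1} ∩ {Im < 0}` beyond `O(|y|⁻¹)` growth**.  Proof: §2 at `D := D⁻` (`conj⁻¹D⁻ = D⁺`) supplies `Φ`, `hΦ₁ hΦ₂ hQ`; `hrel` = §2's raw identity ∘ `exists_fourTerm_tube_cm_two`; then ★ p858922.
[cite: MoeglinWaldspurger1995, IV.3.12 (a)] [cite: Arthur1980TraceFormulaII, §4] [cite: BernsteinLapid2019, §4] -/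
theorem poleControl_continued_cm_two_of_letters_lower
    (μ : Measure (quasiSplit (↥(maximalRealSubfield L)) L (IsCMField.complexConj L) 2).automorphicQuotient) [(quasiSplit (↥(maximalRealSubfield L)) L (IsCMField.complexConj L) 2).IsAutomorphicMeasure μ]
    (νG : Measure (quasiSplit (↥(maximalRealSubfield L)) L (IsCMField.complexConj L) 2).Adelic) [νG.IsHaarMeasure] [νG.IsInvInvariant]
    (μK : Measure ((standardMaximalCompactGL 2 L).comap (adelicVal (↥(maximalRealSubfield L)) L (IsCMField.complexConj L) 2 ((StdForm.antidiagonal 2).over L)) : Subgroup (quasiSplit (↥(maximalRealSubfield L)) L (IsCMField.complexConj L) 2).Adelic))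
    [μK.IsHaarMeasure]
    (νI : Measure (AdeleRing (𝓞 L) L)ˣ) [νI.IsHaarMeasure]
    {𝓕I : Set (AdeleRing (𝓞 L) L)ˣ} (h𝓕I : IsIdeleClassDomain L 𝓕I)
    (ν : Measure ↥(adelicUnipotent (↥(maximalRealSubfield L)) L (IsCMField.complexConj L) 2)) [ν.IsHaarMeasure]
    {𝓕 : Set ↥(adelicUnipotent (↥(maximalRealSubfield L)) L (IsCMField.complexConj L) 2)} (h𝓕N : IsFundamentalDomain ↥(rationalUnipotent (↥(maximalRealSubfield L)) L (IsCMField.complexConj L) 2) 𝓕 ν) (h𝓕1 : ν 𝓕 = 1)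
    (h𝓕c : IsCompact (closure 𝓕))
    {T : ℝ≥0} (hT : 1 ≤ T) {φ₀ : ℂ} (hφ₀ : φ₀ ≠ 0)
    {β : (quasiSplit (↥(maximalRealSubfield L)) L (IsCMField.complexConj L) 2).Adelic → ℝ≥0∞} (hβ : IsCoveringWeight ((arithmeticBorel (↥(maximalRealSubfield L)) L (IsCMField.complexConj L) 2).map (quasiSplit (↥(maximalRealSubfield L)) L (IsCMField.complexConj L) 2).arithmeticSubgroup.subtype) β)
    {c : ℂ → ℂ} (hc : DifferentiableOn ℂ c {w : ℂ | 1 / 2 < w.re ∧ w.im < 0}) (hceq : ∀ z : ℂ, 1 < z.re → c z = (∫ v : ↥(adelicUnipotent (↥(maximalRealSubfield L)) L (IsCMField.complexConj L) 2), (((borelHeight ((quasiSplit (↥(maximalRealSubfield L)) L (IsCMField.complexConj L) 2).toAdelic (weylLongU ((IsCMField.complexConj L : L ≃ₐ[↥(maximalRealSubfield L)] L) : L →+* L) (rfl : (StdForm.antidiagonal 2).over L = (StdForm.antidiagonal 2).over L)) * (v : (quasiSplit (↥(maximalRealSubfield L)) L (IsCMField.complexConj L) 2).Adelic))) : ℝ)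 : ℂ) ^ z ∂ν))
    (Ec : ℂ → (quasiSplit (↥(maximalRealSubfield L)) L (IsCMField.complexConj L) 2).Adelic → ℂ) (hEc : ∀ z : ℂ, 1 < z.re → Ec z = eisensteinSeriesU (flatSectionU (fun _ : (quasiSplit (↥(maximalRealSubfield L)) L (IsCMField.complexConj L) 2).Adelic => φ₀) z))
    (hmeas : ∀ z ∈ {w : ℂ | 1 / 2 < w.re ∧ w.im < 0}, AEStronglyMeasurable ((quasiSplit (↥(maximalRealSubfield L)) L (IsCMField.complexConj L) 2).quotFun (truncation ν 𝓕 T (Ec z))) μ)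
    (hdiff : ∀ g : (quasiSplit (↥(maximalRealSubfield L)) L (IsCMField.complexConj L) 2).Adelic, DifferentiableOn ℂ (fun z : ℂ => truncation ν 𝓕 T (Ec z) g) {w : ℂ | 1 / 2 < w.re ∧ w.im < 0})
    (hbd : ∀ z₀ ∈ {w : ℂ | 1 / 2 < w.re ∧ w.im < 0}, ∃ V ∈ 𝓝 z₀, V ⊆ {w : ℂ | 1 / 2 < w.re ∧ w.im < 0} ∧ ∃ W : (quasiSplit (↥(maximalRealSubfield L)) L (IsCMField.complexConj L) 2).automorphicQuotient → ℝ, MemLp W 2 μ ∧ ∃ C : ℝ, 0 ≤ C ∧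
      ∀ z ∈ V, ∀ x, ‖(quasiSplit (↥(maximalRealSubfield L)) L (IsCMField.complexConj L) 2).quotFun (truncation ν 𝓕 T (Ec z)) x‖ ≤ C * W x)
    {z : ℂ} (hz : z ∈ {w : ℂ | 1 / 2 < w.re ∧ w.im < 0}) :
    Real.sqrt ((∫ x in {x : (AdeleRing (𝓞 L) L)ˣ | (IdeleClassGroup.ideleNorm L x : ℝ) ≤ 1} ∩ 𝓕I, (IdeleClassGroup.ideleNorm L x : ℝ) ∂νI) * μK.real Set.univ * ‖c z‖ ^ 2 * ‖φ₀‖ ^ 2) ≤ (z.re - 1 / 2) * (T : ℝ) ^ (2 * (z.re - 1 / 2)) * Real.sqrt ((∫ x in {x : (AdeleRing (𝓞 L) L)ˣ | (IdeleClassGroup.ideleNorm L x : ℝ) ≤ 1} ∩ 𝓕I, (IdeleClassGroup.ideleNorm L x : ℝ) ∂νI) * μK.real Set.univ * ‖φ₀‖ ^ 2) / |z.im| +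
        Real.sqrt ((z.re - 1 / 2) ^ 2 * (T : ℝ) ^ (4 * (z.re - 1 / 2)) * ((∫ x in {x : (AdeleRing (𝓞 L) L)ˣ | (IdeleClassGroup.ideleNorm L x : ℝ) ≤ 1} ∩ 𝓕I, (IdeleClassGroup.ideleNorm L x : ℝ) ∂νI) * μK.real Set.univ * ‖φ₀‖ ^ 2) / z.im ^ 2 + ((∫ x in {x : (AdeleRing (𝓞 L) L)ˣ | (IdeleClassGroup.ideleNorm L x : ℝ) ≤ 1} ∩ 𝓕I, (IdeleClassGroup.ideleNorm L x : ℝ) ∂νI) * μK.real Set.univ * ‖φ₀‖ ^ 2) * (T : ℝ) ^ (4 * (z.re - 1 / 2))) ∧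
      (∀ {x₁ x₂ η : ℝ}, 0 < x₁ → (z.re - 1 / 2) ∈ Set.Icc x₁ x₂ → 0 < η → η ≤ |z.im| →
        (∫ x in {x : (AdeleRing (𝓞 L) L)ˣ | (IdeleClassGroup.ideleNorm L x : ℝ) ≤ 1} ∩ 𝓕I, (IdeleClassGroup.ideleNorm L x : ℝ) ∂νI) * μK.real Set.univ * ‖c z‖ ^ 2 * ‖φ₀‖ ^ 2 ≤ (x₂ * (T : ℝ) ^ (2 * x₂) * Real.sqrt ((∫ x in {x : (AdeleRing (𝓞 L) L)ˣ | (IdeleClassGroup.ideleNorm L x : ℝ) ≤ 1} ∩ 𝓕I, (IdeleClassGroup.ideleNorm L x : ℝ) ∂νI) * μK.real Set.univ * ‖φ₀‖ ^ 2) / η + Real.sqrt (x₂ ^ 2 * (T : ℝ) ^ (4 * x₂) * ((∫ x in {x : (AdeleRing (𝓞 L) L)ˣ | (IdeleClassGroup.ideleNorm L x : ℝ) ≤ 1} ∩ 𝓕I, (IdeleClassGroup.ideleNorm L x : ℝ) ∂νI) * μK.real Set.univ * ‖φ₀‖ ^ 2) / η ^ 2 + ((∫ x in {x : (AdeleRing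 (𝓞 L) L)ˣ | (IdeleClassGroup.ideleNorm L x : ℝ) ≤ 1} ∩ 𝓕I, (IdeleClassGroup.ideleNorm L x : ℝ) ∂νI) * μK.real Set.univ * ‖φ₀‖ ^ 2) * (T : ℝ) ^ (4 * x₂))) ^ 2) ∧
      (|z.im| ≤ 1 → (∫ x in {x : (AdeleRing (𝓞 L) L)ˣ | (IdeleClassGroup.ideleNorm L x : ℝ) ≤ 1} ∩ 𝓕I, (IdeleClassGroup.ideleNorm L x : ℝ) ∂νI) * μK.real Set.univ * ‖c z‖ ^ 2 * ‖φ₀‖ ^ 2 ≤ ((z.re - 1 / 2) * (T : ℝ) ^ (2 * (z.re - 1 / 2)) * Real.sqrt ((∫ x in {x : (AdeleRing (𝓞 L) L)ˣ | (IdeleClassGroup.ideleNorm L x : ℝ) ≤ 1} ∩ 𝓕I, (IdeleClassGroup.ideleNorm L x : ℝ) ∂νI) * μK.real Set.univ * ‖φ₀‖ ^ 2) +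
        Real.sqrt ((z.re - 1 / 2) ^ 2 * (T : ℝ) ^ (4 * (z.re - 1 / 2)) * ((∫ x in {x : (AdeleRing (𝓞 L) L)ˣ | (IdeleClassGroup.ideleNorm L x : ℝ) ≤ 1} ∩ 𝓕I, (IdeleClassGroup.ideleNorm L x : ℝ) ∂νI) * μK.real Set.univ * ‖φ₀‖ ^ 2) + ((∫ x in {x : (AdeleRing (𝓞 L) L)ˣ | (IdeleClassGroup.ideleNorm L x : ℝ) ≤ 1} ∩ 𝓕I, (IdeleClassGroup.ideleNorm L x : ℝ) ∂νI) * μK.real Set.univ * ‖φ₀‖ ^ 2) * (T : ℝ) ^ (4 * (z.re - 1 / 2)))) ^ 2 / z.im ^ 2)  := by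
  have hDo : IsOpen {w : ℂ | 1 / 2 < w.re ∧ w.im < 0} := (isOpen_lt continuous_const Complex.continuous_re).inter (isOpen_lt Complex.continuous_im continuous_const)
  obtain ⟨F, hF, hΦ₁, hΦ₂, hQ, hraw⟩ := pairing_continued_cm_two_of_letters L ν 𝓕 T φ₀ Ec hEc μ hDo hmeas hdiff hbd
  obtain ⟨cμ, K, hcμ, hK, h4⟩ := exists_fourTerm_tube_cm_two L μ νG μK νI h𝓕I ν h𝓕N h𝓕1 h𝓕c T hT φ₀ hβ c hceq
  have hκr : 0 < (∫ x in {x : (AdeleRing (𝓞 L) L)ˣ | (IdeleClassGroup.ideleNorm L x : ℝ) ≤ 1} ∩ 𝓕I, (IdeleClassGroup.ideleNorm L x : ℝ) ∂νI) := K2E1MaassSelbergSphericalBracketsCMThree.idelicBracket_pos νI h𝓕I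
  have hmK : 0 < μK.real Set.univ := measureReal_maximalCompact_pos μK
  have hconj : {w : ℂ | conj w ∈ {w : ℂ | 1 / 2 < w.re ∧ w.im < 0}} = {z : ℂ | 1 / 2 < z.re ∧ 0 < z.im} := by
    ext w; simp only [Set.mem_setOf_eq, Complex.conj_re, Complex.conj_im, Left.neg_neg_iff]
  have hΦ₂' : ∀ z ∈ {w : ℂ | 1 / 2 < w.re ∧ w.im < 0}, DifferentiableOn ℂ (fun w : ℂ => ⟪F (conj w), F z⟫_ℂ) {z : ℂ | 1 / 2 < z.re ∧ 0 < z.im} := fun z hz => hconj ▸ hΦ₂ z hz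
  have hrel : ∀ z ∈ {w : ℂ | 1 / 2 < w.re ∧ w.im < 0}, ∀ z' ∈ {w : ℂ | 1 / 2 < w.re ∧ w.im < 0}, 1 < z'.re → z'.re < z.re →
      ⟪F z', F z⟫_ℂ = ((cμ : ℝ) : ℂ) * (((K : ℝ) : ℂ) *
        ((((T : ℝ) : ℂ) ^ (z + conj z' - 1) / (z + conj z' - 1)) * ((((∫ x in {x : (AdeleRing (𝓞 L) L)ˣ | (IdeleClassGroup.ideleNorm L x : ℝ) ≤ 1} ∩ 𝓕I, (IdeleClassGroup.ideleNorm L x : ℝ) ∂νI) : ℝ) : ℂ) * (((μK.real Set.univ : ℝ) : ℂ) * (φ₀ * conj φ₀)))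
          + (((T : ℝ) : ℂ) ^ (z - conj z') / (z - conj z')) * ((((∫ x in {x : (AdeleRing (𝓞 L) L)ˣ | (IdeleClassGroup.ideleNorm L x : ℝ) ≤ 1} ∩ 𝓕I, (IdeleClassGroup.ideleNorm L x : ℝ) ∂νI) : ℝ) : ℂ) * (((μK.real Set.univ : ℝ) : ℂ) * (φ₀ * conj (c z' * φ₀))))
          - (((T : ℝ) : ℂ) ^ (-(z - conj z')) / (z - conj z')) * ((((∫ x in {x : (AdeleRing (𝓞 L) L)ˣ | (IdeleClassGroup.ideleNorm L x : ℝ) ≤ 1} ∩ 𝓕I, (IdeleClassGroup.ideleNorm L x : ℝ) ∂νI) : ℝ) : ℂ) * (((μK.real Set.univ : ℝ) : ℂ) * (c z * φ₀ * conj φ₀)))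
          - (((T : ℝ) : ℂ) ^ (-(z + conj z' - 1)) / (z + conj z' - 1)) * ((((∫ x in {x : (AdeleRing (𝓞 L) L)ˣ | (IdeleClassGroup.ideleNorm L x : ℝ) ≤ 1} ∩ 𝓕I, (IdeleClassGroup.ideleNorm L x : ℝ) ∂νI) : ℝ) : ℂ) * (((μK.real Set.univ : ℝ) : ℂ) * (c z * φ₀ * conj (c z' * φ₀)))))) := by
    intro z hz z' hz' h1 h2
    rw [hraw z hz z' hz' (h1.trans h2) h1]
    exact h4 z z' h1 h2
  exact poleControl_continued_cm_two_of_pairing_lower (T := (T : ℝ)) (by exact_mod_cast hT) hcμ hK hκr hmK hφ₀ hc (Φ := fun z z' => ⟪F z', F z⟫_ℂ) hΦ₁ hΦ₂' hrel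
    (Q := fun z => ‖F z‖ ^ 2) hQ hz

end Call

/-! ## §4 (ED. 2, dealer K2E1-plan (g6) (55) 2026-09-04T10:16:31Z) The A.E.-UNIFORM majorant letter (ii″) — what the cusp-decay payer `hK1` actually delivers -/

section AELetters

omit [BorelSpace (quasiSplit (↥(maximalRealSubfield L)) L (IsCMField.complexConj L) 2).Adelic] in
/-- **LETTERS (i′)(m′)(ii″) ⟹ `z ↦ [Λ^TẼ(z)] ∈ L²(X, μ)` IS HOLOMORPHIC ON `D`**, with the majorant only ALMOST EVERYWHERE but UNIFORMLY in `z` on the neighbourhood: (ii″)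
`∀ z₀ ∈ D, ∃ V ∈ 𝓝 z₀, V ⊆ D ∧ ∃ W ∈ L²(μ), ∃ C ≥ 0, ∀ᵐ x ∂μ, ∀ z ∈ V, ‖quotFun Λ^T(Ec z) x‖ ≤ C·W x`.  Proof: on the `z`-FREE exceptional null set replace the family by `0` — the modified
family is still pointwise holomorphic in `z`, a.e. equal to the true one (so it has the same `L²` classes), and satisfies ★ `differentiableOn_of_weighted_bound`'s POINTWISE majorant with `|W|`.
[cite: BernsteinLapid2019, §4 Claim 5] [cite: Rudin1991, Thm. 3.31] -/
theorem exists_toLp_differentiableOn_of_ae_letters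
    (ν : Measure (adelicUnipotent (↥(maximalRealSubfield L)) L (IsCMField.complexConj L) 2)) (𝓕 : Set (adelicUnipotent (↥(maximalRealSubfield L)) L (IsCMField.complexConj L) 2)) (T : ℝ≥0)
    (Ec : ℂ → (quasiSplit (↥(maximalRealSubfield L)) L (IsCMField.complexConj L) 2).Adelic → ℂ) (μ : Measure (quasiSplit (↥(maximalRealSubfield L)) L (IsCMField.complexConj L) 2).automorphicQuotient) {D : Set ℂ}
    (hmeas : ∀ z ∈ D, AEStronglyMeasurable ((quasiSplit (↥(maximalRealSubfield L)) L (IsCMField.complexConj L) 2).quotFun (truncation ν 𝓕 T (Ec z))) μ)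
    (hdiff : ∀ g : (quasiSplit (↥(maximalRealSubfield L)) L (IsCMField.complexConj L) 2).Adelic, DifferentiableOn ℂ (fun z : ℂ => truncation ν 𝓕 T (Ec z) g) D)
    (hbd : ∀ z₀ ∈ D, ∃ V ∈ 𝓝 z₀, V ⊆ D ∧ ∃ W : (quasiSplit (↥(maximalRealSubfield L)) L (IsCMField.complexConj L) 2).automorphicQuotient → ℝ, MemLp W 2 μ ∧ ∃ C : ℝ, 0 ≤ C ∧
      ∀ᵐ x ∂μ, ∀ z ∈ V, ‖(quasiSplit (↥(maximalRealSubfield L)) L (IsCMField.complexConj L) 2).quotFun (truncation ν 𝓕 T (Ec z)) x‖ ≤ C * W x) :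
    ∃ F : ℂ → Lp ℂ 2 μ, DifferentiableOn ℂ F D ∧ ∀ z ∈ D, ((F z : Lp ℂ 2 μ) : (quasiSplit (↥(maximalRealSubfield L)) L (IsCMField.complexConj L) 2).automorphicQuotient → ℂ) =ᵐ[μ] (quasiSplit (↥(maximalRealSubfield L)) L (IsCMField.complexConj L) 2).quotFun (truncation ν 𝓕 T (Ec z)) := by
  classical
  -- `L²` membership at each point of `D`
  have hmem : ∀ z ∈ D, MemLp ((quasiSplit (↥(maximalRealSubfield L)) L (IsCMField.complexConj L) 2).quotFun (truncation ν 𝓕 T (Ec z))) 2 μ := by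
    intro z hz
    obtain ⟨V, hV, -, W, hW, C, hC0, hCW⟩ := hbd z hz
    refine MemLp.of_le_mul (c := C) hW (hmeas z hz) ?_
    filter_upwards [hCW] with x hx
    exact (hx z (mem_of_mem_nhds hV)).trans (mul_le_mul_of_nonneg_left (Real.le_norm_self _) hC0)
  refine ⟨fun z => if h : MemLp ((quasiSplit (↥(maximalRealSubfield L)) L (IsCMField.complexConj L) 2).quotFun (truncation ν 𝓕 T (Ec z))) 2 μ then h.toLp _ else 0, ?_, fun z hz => ?_⟩
  swap
  · dsimp only
    rw [dif_pos (hmem z hz)]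
    exact MemLp.coeFn_toLp _
  intro z₀ hz₀
  obtain ⟨V, hV, hVD, W, hW, C, hC0, hCW⟩ := hbd z₀ hz₀
  have h0V : z₀ ∈ interior V := mem_interior_iff_mem_nhds.2 hV
  have hIV : interior V ⊆ D := interior_subset.trans hVD
  -- the modified family: zero on the `z`-free exceptional set
  set f' : ℂ → (quasiSplit (↥(maximalRealSubfield L)) L (IsCMField.complexConj L) 2).automorphicQuotient → ℂ := fun z x =>
    if ∀ w ∈ V, ‖(quasiSplit (↥(maximalRealSubfield L)) L (IsCMField.complexConj L) 2).quotFun (truncation ν 𝓕 T (Ec w)) x‖ ≤ C * W x then (quasiSplit (↥(maximalRealSubfield L)) L (IsCMField.complexConj L) 2).quotFun (truncation ν 𝓕 T (Ec z)) x else 0 with hf'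
  have hf'ae : ∀ z, f' z =ᵐ[μ] (quasiSplit (↥(maximalRealSubfield L)) L (IsCMField.complexConj L) 2).quotFun (truncation ν 𝓕 T (Ec z)) := fun z => by
    filter_upwards [hCW] with x hx
    simp only [hf', if_pos hx]
  have hdiffV : DifferentiableOn ℂ (fun z => if h : MemLp ((quasiSplit (↥(maximalRealSubfield L)) L (IsCMField.complexConj L) 2).quotFun (truncation ν 𝓕 T (Ec z))) 2 μ then h.toLp _ else 0) (interior V) := by
    refine differentiableOn_of_weighted_bound (μ := μ) (f := f') isOpen_interior (fun x => ?_) (fun s hs => (hmeas s (hIV hs)).congr (hf'ae s).symm)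
      (W := fun x => ‖W x‖) hW.norm hC0 (fun s hs x => ?_) (fun s hs => ?_)
    · by_cases hx : ∀ w ∈ V, ‖(quasiSplit (↥(maximalRealSubfield L)) L (IsCMField.complexConj L) 2).quotFun (truncation ν 𝓕 T (Ec w)) x‖ ≤ C * W x
      · simp only [hf', if_pos hx]
        exact (hdiff _).mono hIV
      · simp only [hf', if_neg hx]
        exact differentiableOn_const _
    · by_cases hx : ∀ w ∈ V, ‖(quasiSplit (↥(maximalRealSubfield L)) L (IsCMField.complexConj L) 2).quotFun (truncation ν 𝓕 T (Ec w)) x‖ ≤ C * W x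
      · simp only [hf', if_pos hx]
        exact (hx s (interior_subset hs)).trans (mul_le_mul_of_nonneg_left (Real.le_norm_self _) hC0)
      · simp only [hf', if_neg hx, norm_zero]
        exact mul_nonneg hC0 (norm_nonneg _)
    · show (((if h : MemLp ((quasiSplit (↥(maximalRealSubfield L)) L (IsCMField.complexConj L) 2).quotFun (truncation ν 𝓕 T (Ec s))) 2 μ then h.toLp _ else 0 : Lp ℂ 2 μ)) : (quasiSplit (↥(maximalRealSubfield L)) L (IsCMField.complexConj L) 2).automorphicQuotient → ℂ) =ᵐ[μ] f' s
      rw [dif_pos (hmem s (hIV hs))]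
      exact (MemLp.coeFn_toLp _).trans (hf'ae s).symm
  exact ((hdiffV z₀ h0V).differentiableAt (isOpen_interior.mem_nhds h0V)).differentiableWithinAt

omit [BorelSpace (quasiSplit (↥(maximalRealSubfield L)) L (IsCMField.complexConj L) 2).Adelic] in
/-- **HEAD (ED. 2) — THE PAIRING OF THE CONTINUED FAMILY FROM THE A.E.-UNIFORM LETTER (ii″)**: exactly `pairing_continued_cm_two_of_letters` with (ii′) weakened to (ii″) — the form the cusp-decay
payer `hK1` (★ K2, a.e. on the truncated quotient) supplies after `pZX`-transport and the `R(h) ∘ (·)_B` commutation. [cite: MoeglinWaldspurger1995, IV.3.12] [cite: BernsteinLapid2019, §4 Claim 5] -/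
theorem pairing_continued_cm_two_of_ae_letters
    (ν : Measure (adelicUnipotent (↥(maximalRealSubfield L)) L (IsCMField.complexConj L) 2)) (𝓕 : Set (adelicUnipotent (↥(maximalRealSubfield L)) L (IsCMField.complexConj L) 2)) (T : ℝ≥0) (φ₀ : ℂ)
    (Ec : ℂ → (quasiSplit (↥(maximalRealSubfield L)) L (IsCMField.complexConj L) 2).Adelic → ℂ) (hEc : ∀ z : ℂ, 1 < z.re → Ec z = eisensteinSeriesU (flatSectionU (fun _ : (quasiSplit (↥(maximalRealSubfield L)) L (IsCMField.complexConj L) 2).Adelic => φ₀) z))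
    (μ : Measure (quasiSplit (↥(maximalRealSubfield L)) L (IsCMField.complexConj L) 2).automorphicQuotient) {D : Set ℂ} (hD : IsOpen D)
    (hmeas : ∀ z ∈ D, AEStronglyMeasurable ((quasiSplit (↥(maximalRealSubfield L)) L (IsCMField.complexConj L) 2).quotFun (truncation ν 𝓕 T (Ec z))) μ)
    (hdiff : ∀ g : (quasiSplit (↥(maximalRealSubfield L)) L (IsCMField.complexConj L) 2).Adelic, DifferentiableOn ℂ (fun z : ℂ => truncation ν 𝓕 T (Ec z) g) D)
    (hbd : ∀ z₀ ∈ D, ∃ V ∈ 𝓝 z₀, V ⊆ D ∧ ∃ W : (quasiSplit (↥(maximalRealSubfield L)) L (IsCMField.complexConj L) 2).automorphicQuotient → ℝ, MemLp W 2 μ ∧ ∃ C : ℝ, 0 ≤ C ∧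
      ∀ᵐ x ∂μ, ∀ z ∈ V, ‖(quasiSplit (↥(maximalRealSubfield L)) L (IsCMField.complexConj L) 2).quotFun (truncation ν 𝓕 T (Ec z)) x‖ ≤ C * W x) :
    ∃ F : ℂ → Lp ℂ 2 μ,
      (∀ z ∈ D, ((F z : Lp ℂ 2 μ) : (quasiSplit (↥(maximalRealSubfield L)) L (IsCMField.complexConj L) 2).automorphicQuotient → ℂ) =ᵐ[μ] (quasiSplit (↥(maximalRealSubfield L)) L (IsCMField.complexConj L) 2).quotFun (truncation ν 𝓕 T (Ec z))) ∧
      (∀ z' ∈ D, DifferentiableOn ℂ (fun z : ℂ => ⟪F z', F z⟫_ℂ) D) ∧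
      (∀ z ∈ D, DifferentiableOn ℂ (fun w : ℂ => ⟪F (conj w), F z⟫_ℂ) {w : ℂ | conj w ∈ D}) ∧
      (∀ z ∈ D, 0 ≤ ‖F z‖ ^ 2 ∧ ⟪F z, F z⟫_ℂ = (((‖F z‖ ^ 2 : ℝ)) : ℂ)) ∧
      (∀ z ∈ D, ∀ z' ∈ D, 1 < z.re → 1 < z'.re →
        ⟪F z', F z⟫_ℂ = ∫ x, (quasiSplit (↥(maximalRealSubfield L)) L (IsCMField.complexConj L) 2).quotFun (truncation ν 𝓕 T (eisensteinSeriesU (flatSectionU (fun _ : (quasiSplit (↥(maximalRealSubfield L)) L (IsCMField.complexConj L) 2).Adelic => φ₀) z))) x * conj ((quasiSplit (↥(maximalRealSubfield L)) L (IsCMField.complexConj L) 2).quotFun (truncation ν 𝓕 T (eisensteinSeriesU (flatSectionU (fun _ : (quasiSplit (↥(maximalRealSubfield L)) L (IsCMField.complexConj L) 2).Adelic => φ₀) z'))) x) ∂μ) := by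
  obtain ⟨F, hFd, hF⟩ := exists_toLp_differentiableOn_of_ae_letters L ν 𝓕 T Ec μ hmeas hdiff hbd
  obtain ⟨h₁, h₂, h₃⟩ := pairing_of_differentiableOn hD hFd
  refine ⟨F, hF, h₁, h₂, h₃, fun z hz z' hz' hz1 hz'1 => ?_⟩
  rw [MeasureTheory.L2.inner_def]
  refine integral_congr_ae ?_
  filter_upwards [hF z hz, hF z' hz'] with x hx hx'
  rw [hx, hx', RCLike.inner_apply, hEc z hz1, hEc z' hz'1, mul_comm]

end AELetters

end Summit.HodgeConjecture.HodgeConjecture.Cruxes.H413.K2E1MaassSelbergPairingContinuedCMTwo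

end
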